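import Mathlib
import Summits.CriticalPhenomena.CardyFormulaZ2.Theses.CardyFlipRusso
import Summits.CriticalPhenomena.CardyFormulaZ2.Theorems.CardyFlipRussoSquareFromVoronoiHubDefs
import Summits.CriticalPhenomena.CardyFormulaZ2.Theorems.CardyFlipRussoSquareFromVoronoiHubDecimationDefs
import Summits.CriticalPhenomena.CardyFormulaZ2.Theorems.CardyFlipRussoSquareFromVoronoiHubDecimateForward
import Summits.CriticalPhenomena.CardyFormulaZ2.Theorems.CardyFlipRussoSquareFromVoronoiHubDecimateBackward
import Summits.CriticalPhenomena.CardyFormulaZ2.Theorems.CardyFlipRussoSquareFromVoronoiHubDecimateMeasure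
import Summits.CriticalPhenomena.CardyFormulaZ2.Theorems.CardyFlipRussoSquareFromVoronoiHubCrudeUpper
import Literature.Probability.Percolation.SiteEmbDomainCrossing
import Literature.Probability.Percolation.BoxCrossingProofs
import Literature.Probability.Percolation.CardyFormula
import Literature.Probability.Percolation.VoronoiCrossing
import Literature.Analysis.FunctionSpaces.PoissonPointProcess

/-!
# Line `centre-decimation` (card `Ideas/centre-decimation.md`) — skeleton v3 for crux `SquareFromVoronoiHub`
(stmt-CriticalPhenomena-6434), lead `prover-line-stmt-CriticalPhenomena-6434-c2-0` (c2, seated 2026-08-16T23:07Z on the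
registered skeleton v2 of lead c1, sha 82565cc1; statements and stubs UNCHANGED — only this header differs)

Route `CardyFlipRusso`, crux decl
`Summit.CriticalPhenomena.CardyFormulaZ2.Theses.CardyFlipRusso.SquareFromVoronoiHub`:
Cardy's formula for annealed Poisson–Voronoi percolation (continuum-path event, every conformal
rectangle) ⇒ Cardy's formula for site percolation at `1/2` on the centred square lattice `G_s`
(crude `2δ`-slack event, every conformal rectangle).

Line: DECIMATE THE CENTRES.  A face centre of `G_s` is adjacent only to the four corners of its
face, so for critical site percolation it changes the connectivity of the `ℤ²`-sites exactly when
the open corners of the face inside the window are a diagonal pair, and then acts as an independent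
fair coin; relabelling that coin by the corner colours (`decimate`) is a measure-preserving
bijection onto the ANNEALED RANDOM-DIAGONAL square lattice (`ℤ²` site colours + one independent
fair diagonal per face, `diagGraph`/`diagLaw`).  Hence (CD) `P_{G_s}[U ↔ V in inl''A ∪ inr''B] =
P_diag[U ↔ V in A, diagonals in B]` (`CentreDecimationIdentity`), the crux's crude event is squeezed
`E_diag(2δ) ⊆ E_{G_s}(2δ) ⊆ E_diag(3δ)` once `4δ < dist(arc 0, arc 2)`, and the crux follows from
the TRANSFERRED CRUX C⁺ = `VoronoiToRandomDiagonal` (Cardy for annealed Poisson–Voronoi ⇒ Cardy for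
the random-diagonal lattice at slacks 2 and 3) by a `Tendsto` squeeze (`of_parts`, sorry-free).

Objects: module `Theorems/CardyFlipRussoSquareFromVoronoiHubDecimationDefs.lean` (LANDED p128672,
namespace `…Cruxes.SquareFromVoronoiHub.CentreDecimation`): `diagGraph`, `diagLaw`, `gsConn`,
`diagConn`, `antiDiagFaces`, `decimate`, `siteWindow`, `faceWindow`, `nearArc`, `diagCrude`,
`diagCrossingProb`, and the dictionary `Gs_eq_centredSquareGraph : Gs = centredSquareGraph`.

Stubs (registered):
* `stub_decimateForward`  (CD, events ⇒) — LANDED p129234, Theorems/…DecimateForward.lean (wave 1).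
* `stub_decimateBackward` (CD, events ⇐) — LANDED p129463, Theorems/…DecimateBackward.lean (wave 1).
* `stub_decimateMeasure`  (CD, law: `decimate A` is a measure-preserving measurable equivalence onto
  `diagLaw`, preimage identity for ALL sets) — LANDED p129960, Theorems/…DecimateMeasure.lean (wave 1).
* `stub_crudeUpper` (squeeze, upper inclusion for `0 < δ`, `4δ < dist(arc 0, arc 2)`) — LANDED p130137,
  Theorems/…CrudeUpper.lean (wave 1).
* `stub_voronoiToRandomDiagonal` (C⁺, the ONLY remaining sorry, held by the lead): it carries the
  crux's open universality content (annealed Poisson–Voronoi ⇒ ℤ² ⊕ i.i.d. fair diagonals).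
Closed here (no sorry): the lower inclusion, the window dictionary, (CD) `centreDecimation` from its
three landed stubs, the two probability bounds, the squeeze `gsCardy_of_randomDiagonal`, `of_parts`,
and `SquareFromVoronoiHub_of` concluding the crux BY NAME (modulo C⁺ only).

Disproof.lean: absent (`ledger crux ls`, 2026-08-16T22:05Z and 23:09Z); re-read every turn.
-/

noncomputable section

open scoped Topology MeasureTheory
open Filter Set MeasureTheory
open UpperHalfPlane (upperHalfPlaneSet)
open Literature.Analysis.FunctionSpaces (PointConfig IsPoissonPointProcess)
open Literature.Probability.RandomPlanarGeometry (ConformalRectangle ConformalEquiv cardyFunction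
  crossRatio)
open Literature.Probability.Percolation (SiteConfig sitePercolation siteConnIn half
  centredSquareGraph centredSquareEmbedding)
open Summit.CriticalPhenomena.CardyFormulaZ2.Cruxes.SquareFromVoronoiHub.VoronoiBlocks
  (zGs Gs crudeCrossing siteCrossingProb voronoiCrossingProb)

/-! ## The line (namespace `…CentreDecimationLine`) -/

namespace Summit.CriticalPhenomena.CardyFormulaZ2.Cruxes.SquareFromVoronoiHub.CentreDecimationLine

open Summit.CriticalPhenomena.CardyFormulaZ2.Theses
open Summit.CriticalPhenomena.CardyFormulaZ2.Cruxes.SquareFromVoronoiHub.CentreDecimation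

/-! ### The crux, named -/

/-- The crux's hypothesis: Cardy's formula for annealed Poisson–Voronoi percolation. -/
def VoronoiCardy : Prop :=
  ∀ (PB PW : Measure (PointConfig ℂ)),
    IsPoissonPointProcess (volume : Measure ℂ) PB → IsPoissonPointProcess (volume : Measure ℂ) PW →
    ∀ R : ConformalRectangle, R.HasCrossingLimit (voronoiCrossingProb PB PW R) cardyFunction

/-- The crux's conclusion: Cardy's formula for critical site percolation on `G_s` (crude event). -/
def GsCardy : Prop :=
  ∀ R : ConformalRectangle, R.HasCrossingLimit (siteCrossingProb R) cardyFunction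

/-- SANITY (`Iff.rfl`): the crux BY NAME is `VoronoiCardy → GsCardy`. -/
theorem crux_iff : CardyFlipRusso.SquareFromVoronoiHub ↔ (VoronoiCardy → GsCardy) :=
  Iff.rfl

/-! ### The statements of the line -/

/-- (CD) The centre-decimation identity. -/
def CentreDecimationIdentity : Prop :=
  ∀ A B U V : Set (ℤ × ℤ),
    (sitePercolation ((ℤ × ℤ) ⊕ (ℤ × ℤ)) half).real (gsConn A B U V) =
      diagLaw.real (diagConn A B U V)

/-- Cardy's formula for the annealed random-diagonal square lattice, crude event with slack `c δ`. -/
def RandomDiagonalCardy (c : ℝ) : Prop :=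
  ∀ R : ConformalRectangle, R.HasCrossingLimit (diagCrossingProb R c) cardyFunction

/-- C⁺ — the transferred crux of the line. -/
def VoronoiToRandomDiagonal : Prop :=
  VoronoiCardy → RandomDiagonalCardy 2 ∧ RandomDiagonalCardy 3

/-! ### The stubs -/

/-- **stub_decimateForward** (CD, events, `⇒`; LANDED p129234): an open `G_s` connection from `inl u` to `inl v`
inside the window `inl''A ∪ inr''B` becomes, under `decimate A`, an open random-diagonal connection
from `u` to `v` inside `A` with diagonals admitted in `B` (each visit of a centre is replaced by a
corner detour or by the diagonal the relabelled coin provides). -/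
theorem stub_decimateForward :
    ∀ (A B U V : Set (ℤ × ℤ)) (ω : SiteConfig ((ℤ × ℤ) ⊕ (ℤ × ℤ))),
      ω ∈ gsConn A B U V → decimate A ω ∈ diagConn A B U V :=
  CentreDecimation.stub_decimateForward

/-- **stub_decimateBackward** (CD, events, `⇐`; LANDED p129463): conversely, every open random-diagonal connection
of `decimate A ω` lifts to an open `G_s` connection of `ω` (a diagonal step is replaced by the open
centre or by a corner detour). -/
theorem stub_decimateBackward :
    ∀ (A B U V : Set (ℤ × ℤ)) (ω : SiteConfig ((ℤ × ℤ) ⊕ (ℤ × ℤ))),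
      decimate A ω ∈ diagConn A B U V → ω ∈ gsConn A B U V :=
  CentreDecimation.stub_decimateBackward

/-- **stub_decimateMeasure** (CD, law; LANDED p129960): `decimate A` transports critical site percolation on `G_s`
to the annealed random-diagonal law — for EVERY set `E` (it is a measurable equivalence: the centre
coins are flipped on a set of faces determined by the independent site colours, which preserves the
fair product law, `MeasurePreserving.skew_product`). -/
theorem stub_decimateMeasure :
    ∀ (A : Set (ℤ × ℤ)) (E : Set (Set (ℤ × ℤ) × Set (ℤ × ℤ))),
      sitePercolation ((ℤ × ℤ) ⊕ (ℤ × ℤ)) half (decimate A ⁻¹' E) = diagLaw E :=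
  CentreDecimation.stub_decimateMeasure

/-- **stub_crudeUpper** (squeeze, upper inclusion; LANDED p130137): once `4δ` is smaller than the distance between
the arcs `(ab)` and `(cd)`, every crude `G_s` crossing contains an open `G_s` connection between
`ℤ²`-SITES within `3δ` of the two arcs (a centre endpoint within `2δ` of an arc is not alone on the
path, and its path-neighbour is a corner at distance `δ/√2 < δ`). -/
theorem stub_crudeUpper :
    ∀ (R : ConformalRectangle) {δ : ℝ}, 0 < δ →
      (∀ a ∈ R.arc 0, ∀ b ∈ R.arc 2, 4 * δ < dist a b) →
      crudeCrossing R δ ⊆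
        gsConn (siteWindow R δ) (faceWindow R δ) (nearArc R 0 3 δ) (nearArc R 2 3 δ) :=
  CentreDecimation.stub_crudeUpper

/-- **stub_voronoiToRandomDiagonal** (C⁺; the hardest stub, held by the lead — it carries the
crux's universality content). -/
theorem stub_voronoiToRandomDiagonal : VoronoiToRandomDiagonal := by
  sorry

/-! ### Closed parts (no sorry) -/

/-- The vertex window of the crux splits into the site window and the face window. -/
theorem window_eq (R : ConformalRectangle) (δ : ℝ) :
    {y : (ℤ × ℤ) ⊕ (ℤ × ℤ) | (δ : ℂ) * zGs y ∈ R.carrier} =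
      Sum.inl '' siteWindow R δ ∪ Sum.inr '' faceWindow R δ := by
  ext y
  rcases y with x | f
  · simp [siteWindow]
  · simp [faceWindow]

/-- (CD) from its three stubs. -/
theorem centreDecimation : CentreDecimationIdentity := by
  intro A B U V
  have hset : gsConn A B U V = decimate A ⁻¹' diagConn A B U V := by
    ext ω
    exact ⟨stub_decimateForward A B U V ω, stub_decimateBackward A B U V ω⟩
  rw [measureReal_def, measureReal_def, hset, stub_decimateMeasure]

/-- Squeeze, lower inclusion (definitional bookkeeping): a random-diagonal-shaped `G_s` connection
between sites within `2δ` of the arcs IS a crude crossing. -/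
theorem gsConn_two_subset_crudeCrossing (R : ConformalRectangle) (δ : ℝ) :
    gsConn (siteWindow R δ) (faceWindow R δ) (nearArc R 0 2 δ) (nearArc R 2 2 δ) ⊆
      crudeCrossing R δ := by
  rintro ω ⟨u, hu, v, hv, h⟩
  refine ⟨Sum.inl u, Sum.inl v, hu, hv, ?_⟩
  rwa [window_eq]

/-- Lower bound: `diag(2δ) ≤ site(δ)` for every `δ`. -/
theorem diag_two_le_site (R : ConformalRectangle) (δ : ℝ) :
    diagCrossingProb R 2 δ ≤ siteCrossingProb R δ := by
  unfold diagCrossingProb diagCrude siteCrossingProb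
  rw [← centreDecimation]
  exact measureReal_mono (gsConn_two_subset_crudeCrossing R δ) (measure_ne_top _ _)

/-- Upper bound: `site(δ) ≤ diag(3δ)` once `0 < δ` and `4δ < dist(arc 0, arc 2)`. -/
theorem site_le_diag_three (R : ConformalRectangle) {δ : ℝ} (hδ : 0 < δ)
    (hfar : ∀ a ∈ R.arc 0, ∀ b ∈ R.arc 2, 4 * δ < dist a b) :
    siteCrossingProb R δ ≤ diagCrossingProb R 3 δ := by
  unfold diagCrossingProb diagCrude siteCrossingProb
  rw [← centreDecimation]
  exact measureReal_mono (stub_crudeUpper R hδ hfar) (measure_ne_top _ _)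

/-- **The squeeze**: Cardy for the random-diagonal lattice at slacks `2` and `3` gives Cardy for
critical site percolation on `G_s` (crude event). -/
theorem gsCardy_of_randomDiagonal (h2 : RandomDiagonalCardy 2) (h3 : RandomDiagonalCardy 3) :
    GsCardy := by
  intro R φ x hux
  obtain ⟨ε, hε, hεd⟩ := R.exists_pos_forall_lt_dist_arc
  have hlo : ∀ᶠ δ in 𝓝[>] (0 : ℝ), diagCrossingProb R 2 δ ≤ siteCrossingProb R δ :=
    Eventually.of_forall fun δ => diag_two_le_site R δ
  have hhi : ∀ᶠ δ in 𝓝[>] (0 : ℝ), siteCrossingProb R δ ≤ diagCrossingProb R 3 δ := by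
    have hI : Ioo (0 : ℝ) (ε / 4) ∈ 𝓝[>] (0 : ℝ) := Ioo_mem_nhdsGT (by positivity)
    filter_upwards [hI] with δ hδ
    refine site_le_diag_three R hδ.1 fun a ha b hb => ?_
    have := hεd a ha b hb
    linarith [hδ.2]
  exact tendsto_of_tendsto_of_tendsto_of_le_of_le' (h2 R φ x hux) (h3 R φ x hux) hlo hhi

/-- **The composition (no sorry):** C⁺ implies the crux in the form `VoronoiCardy → GsCardy`. -/
theorem of_parts (hC : VoronoiToRandomDiagonal) : VoronoiCardy → GsCardy :=
  fun hV => gsCardy_of_randomDiagonal (hC hV).1 (hC hV).2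

/-- **The composition, closed form:** the registered stubs imply the crux, stated with the crux
decl BY NAME. -/
theorem SquareFromVoronoiHub_of : CardyFlipRusso.SquareFromVoronoiHub :=
  crux_iff.mpr (of_parts stub_voronoiToRandomDiagonal)

end Summit.CriticalPhenomena.CardyFormulaZ2.Cruxes.SquareFromVoronoiHub.CentreDecimationLine

end
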